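import Summits.QuantumFields.YangMills.Theorems.LuscherReductionOneSiteLevelsKacFlat
import Literature.Analysis.OperatorTheory.YangMillsMatrixModelAL1Holds
import HarnessLib

/-!
# The FLAT annulus Kac-form bound: `(E − Ct)‖g‖² ≤ kacForm t g` for colour-invariant `g` supported in `{R'(E) ≤ ‖x‖ ≤ κ/√t}` (`E` arbitrary)
# (route `FlatTubeReduction`, crux K1 `NearFlatRatioLaw` stmt-QuantumFields-24720, skeleton «ratepack-v2», stub `stub_outerCoercive`; seat `ym-line-ftr-p1` g11;
# R2b1 RECORD rung — no summit statement is proved here)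

Flat side (`ZM = ℝ⁹`, `𝔥 = −½Δ + V`, `V = luscherPotential`, `kacForm t g = flatJump t g + ∫ V g²`) of the eigen-scale OUTER COERCIVITY: B. Simon's confinement
«test functions supported away from the origin have large energy» in the Kac-form currency of crux ONE, with an `O(t)` deficit.  NO new analysis: the landed span / cross /
remainder estimates of the FLAT lane of crux ONE (`kacForm_span_ge`, `abs_kacBil_span_le`, `kacForm_remainder_ge`, `remainder_package`) for the AL1 eigenfamily `f_0,…,f_m`
(`LuscherHamiltonianEigenfunctions_holds`, `m` with `physLevel (m+2) ≥ E + 96κ² + 3`), exactly as in `flatKac_window`, with the ORTHOGONALITY `g ⊥ f_j` replaced by the SUPPORT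
condition `g = 0` on `{‖x‖ < R'}`: the coefficients `c_j = ⟨g, f_j⟩` are then small by the second moment of the span (`integral_norm_sq_mul_eigSpan_sq_le`):
`Σ c_j² = ⟨g, F⟩ ≤ R'⁻¹ ∫ |g|·‖x‖|F| ≤ (M₂ + R') R'⁻² ‖g‖²` (`F = Σ c_j f_j`), so `(E+1)Σc_j² ≤ ‖g‖²` once `R' ≥ E + M₂ + 2`, and the three estimates sum to
`kacForm t g ≥ (E + 1)‖r‖² − C t Σ c_j² ≥ (E − Ct)‖g‖²`.
Main theorem: `RateTube.flatKac_annulus`.  HONEST FRAMING: a lemma about the nine-dimensional matrix-model Schrödinger operator; femto rung R2b1 (RECORD label); not infinite volume,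
not a gap, not Clay.  No defs, no named-fact hypotheses, no `sorry`.
-/

set_option autoImplicit false

noncomputable section

open MeasureTheory Filter Topology Real
open scoped BigOperators
open Literature.Analysis.OperatorTheory.YMMatrixModel

namespace Summit.QuantumFields.YangMills.Theorems.FemtoTransferGap.RateTube

open Summit.QuantumFields.YangMills.Theorems.FemtoTransferGap

section Family

variable {m : ℕ} {f : Fin (m + 1) → ZM → ℝ}

/-- `⟨g, F⟩ = Σ c_j²` for `F = Σ c_j f_j`, `c_j = ⟨g, f_j⟩` (bounded measurable ball-supported `g`, AL1 family `f`). [folklore] -/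
theorem integral_mul_eigSpan_eq_sum_sq (hf : IsEigenFamily m f) {g : ZM → ℝ} (hgm : Measurable g) {M R : ℝ} (hgb : ∀ x, |g x| ≤ M)
    (hsupp : ∀ x, g x ≠ 0 → ‖x‖ ≤ R) (c : Fin (m + 1) → ℝ) (hc : ∀ j, c j = ∫ x, g x * f j x) :
    ∫ x, g x * eigSpan f c x = ∑ j, c j ^ 2 := by
  obtain ⟨hgi, -, -, -, -⟩ := datum_integrable hgm hgb hsupp
  have Igf : ∀ j, Integrable fun x => c j * (g x * f j x) := fun j =>
    (hgi.mul_bdd (hf.1 j 0).continuous.aestronglyMeasurable (ae_of_all _ fun x => by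
      rw [Real.norm_eq_abs]; exact ((hf.2.2.2.2 j).abs_le.choose_spec x))).const_mul _
  have e : ∫ x, g x * eigSpan f c x = ∫ x, ∑ j, c j * (g x * f j x) :=
    integral_congr_ae (Eventually.of_forall fun x => by
      simp only [eigSpan_apply, Finset.mul_sum]; exact Finset.sum_congr rfl fun j _ => by ring)
  rw [e, integral_finsetSum _ fun j _ => Igf j]
  exact Finset.sum_congr rfl fun j _ => by rw [integral_const_mul, ← hc j, sq]

/-- **Tail of the coefficients.**  If `g` vanishes on `{‖x‖ < R'}` (`R' > 0`) then `Σ c_j² ≤ (M₂ + R') R'⁻² ∫ g²`, `M₂` the second-moment constant of the span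
(`∫ ‖x‖² F² ≤ M₂ Σ c_j²`). [folklore] -/
theorem sum_sq_coeff_le_of_vanish (hf : IsEigenFamily m f) {M₂ : ℝ} (hM₂0 : 0 ≤ M₂)
    (hM₂ : ∀ c : Fin (m + 1) → ℝ, Integrable (fun x => ‖x‖ ^ 2 * eigSpan f c x ^ 2) ∧ ∫ x, ‖x‖ ^ 2 * eigSpan f c x ^ 2 ≤ M₂ * ∑ j, c j ^ 2)
    {g : ZM → ℝ} (hgm : Measurable g) {M R R' : ℝ} (hgb : ∀ x, |g x| ≤ M) (hsupp : ∀ x, g x ≠ 0 → ‖x‖ ≤ R) (hR' : 0 < R')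
    (hvan : ∀ x, g x ≠ 0 → R' ≤ ‖x‖) (c : Fin (m + 1) → ℝ) (hc : ∀ j, c j = ∫ x, g x * f j x) :
    ∑ j, c j ^ 2 ≤ (M₂ + R') / R' ^ 2 * ∫ x, g x ^ 2 := by
  obtain ⟨-, -, -, -, hg2⟩ := datum_integrable hgm hgb hsupp
  obtain ⟨hF2i, hF2le⟩ := hM₂ c
  set S : ℝ := ∑ j, c j ^ 2 with hSdef
  set X : ℝ := ∫ x, g x ^ 2 with hXdef
  have hS0 : 0 ≤ S := Finset.sum_nonneg fun j _ => sq_nonneg _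
  have hX0 : 0 ≤ X := integral_nonneg fun x => sq_nonneg _
  set θ : ℝ := M₂ / R' + 1 with hθ
  have hθ0 : 0 < θ := by rw [hθ]; positivity
  -- pointwise AM–GM: `g F ≤ R'⁻¹ (θ/2 g² + (2θ)⁻¹ ‖x‖² F²)` (both sides vanish off the support of `g`)
  have hpt : ∀ x, g x * eigSpan f c x ≤ (θ / 2 / R') * g x ^ 2 + (1 / (2 * θ) / R') * (‖x‖ ^ 2 * eigSpan f c x ^ 2) := by
    intro x
    by_cases hx : g x = 0
    · rw [hx]; simp; positivity
    · have hxR : R' ≤ ‖x‖ := hvan x hx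
      have h1 : 1 ≤ ‖x‖ / R' := by rw [le_div_iff₀ hR']; linarith
      -- `|g F| ≤ |g|·(‖x‖/R')·|F| ≤ θ/(2R') g² + ‖x‖²F²/(2θR')`
      have hgF : g x * eigSpan f c x ≤ |g x| * (‖x‖ / R' * |eigSpan f c x|) := by
        calc g x * eigSpan f c x ≤ |g x * eigSpan f c x| := le_abs_self _
          _ = |g x| * (1 * |eigSpan f c x|) := by rw [abs_mul, one_mul]
          _ ≤ |g x| * (‖x‖ / R' * |eigSpan f c x|) :=
              mul_le_mul_of_nonneg_left (mul_le_mul_of_nonneg_right h1 (abs_nonneg _)) (abs_nonneg _)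
      have hamgm : |g x| * (‖x‖ / R' * |eigSpan f c x|) ≤ (θ / 2 / R') * g x ^ 2 + (1 / (2 * θ) / R') * (‖x‖ ^ 2 * eigSpan f c x ^ 2) := by
        have key : 0 ≤ (θ * |g x| - ‖x‖ * |eigSpan f c x|) ^ 2 := sq_nonneg _
        have e1 : |g x| * (‖x‖ / R' * |eigSpan f c x|) = (|g x| * (‖x‖ * |eigSpan f c x|)) / R' := by ring
        have e2 : (θ / 2 / R') * g x ^ 2 + (1 / (2 * θ) / R') * (‖x‖ ^ 2 * eigSpan f c x ^ 2)
            = ((θ / 2) * |g x| ^ 2 + (1 / (2 * θ)) * (‖x‖ ^ 2 * |eigSpan f c x| ^ 2)) / R' := by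
          rw [sq_abs, sq_abs]; ring
        rw [e1, e2, div_le_div_iff_of_pos_right hR']
        have h3 : |g x| * (‖x‖ * |eigSpan f c x|) * θ ≤ ((θ / 2) * |g x| ^ 2 + (1 / (2 * θ)) * (‖x‖ ^ 2 * |eigSpan f c x| ^ 2)) * θ := by
          have e3 : ((θ / 2) * |g x| ^ 2 + (1 / (2 * θ)) * (‖x‖ ^ 2 * |eigSpan f c x| ^ 2)) * θ
              = (θ ^ 2 * |g x| ^ 2 + ‖x‖ ^ 2 * |eigSpan f c x| ^ 2) / 2 := by field_simp
          rw [e3]; nlinarith [key]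
        exact le_of_mul_le_mul_right h3 hθ0
      exact hgF.trans hamgm
  have hIr : Integrable fun x => (θ / 2 / R') * g x ^ 2 + (1 / (2 * θ) / R') * (‖x‖ ^ 2 * eigSpan f c x ^ 2) :=
    (hg2.const_mul _).add (hF2i.const_mul _)
  -- `⟨g,F⟩` is integrable (bounded × continuous on a ball): via `integral_mul_eigSpan_eq_sum_sq` we only need the value
  have hgF : ∫ x, g x * eigSpan f c x = S := integral_mul_eigSpan_eq_sum_sq hf hgm hgb hsupp c hc
  have hgFi : Integrable fun x => g x * eigSpan f c x := by
    obtain ⟨hgi, -, -, -, -⟩ := datum_integrable hgm hgb hsupp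
    obtain ⟨C, hC0, hC⟩ := eigSpan_decay hf c
    exact hgi.mul_bdd (c := C) (eigSpan_contDiff hf c 0).continuous.aestronglyMeasurable (ae_of_all _ fun x => by
      rw [Real.norm_eq_abs]
      exact ((hC x).1).trans (mul_le_of_le_one_right hC0 (Real.exp_le_one_iff.mpr (neg_nonpos.mpr (norm_nonneg x)))))
  have hmain : S ≤ (θ / 2 / R') * X + (1 / (2 * θ) / R') * (M₂ * S) := by
    have h := integral_mono hgFi hIr hpt
    rw [hgF, integral_add (hg2.const_mul _) (hF2i.const_mul _), integral_const_mul, integral_const_mul] at h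
    have h2 : (1 / (2 * θ) / R') * (∫ x, ‖x‖ ^ 2 * eigSpan f c x ^ 2) ≤ (1 / (2 * θ) / R') * (M₂ * S) :=
      mul_le_mul_of_nonneg_left hF2le (by positivity)
    linarith
  -- `M₂/(2θR') ≤ 1/2` since `θ ≥ M₂/R'`; hence `S/2 ≤ θX/(2R')`, `S ≤ θX/R' = (M₂ + R')X/R'²`
  have hhalf : (1 / (2 * θ) / R') * (M₂ * S) ≤ S / 2 := by
    have hθge : M₂ / R' ≤ θ := by rw [hθ]; linarith
    have : (1 / (2 * θ) / R') * M₂ ≤ 1 / 2 := by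
      rw [div_mul_eq_mul_div, one_div_mul_eq_div, div_div, div_le_iff₀ (by positivity)]
      have := mul_le_mul_of_nonneg_left hθge (by norm_num : (0 : ℝ) ≤ 1 / 2)
      calc M₂ = (M₂ / R') * R' := by field_simp
        _ ≤ θ * R' := mul_le_mul_of_nonneg_right hθge hR'.le
        _ = 1 / 2 * (2 * θ * R') := by ring
    calc (1 / (2 * θ) / R') * (M₂ * S) = ((1 / (2 * θ) / R') * M₂) * S := by ring
      _ ≤ 1 / 2 * S := mul_le_mul_of_nonneg_right this hS0
      _ = S / 2 := by ring
  have hS : S ≤ θ / R' * X := by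
    have e2 : θ / 2 / R' * X = (θ / R' * X) / 2 := by ring
    rw [e2] at hmain
    linarith [hmain, hhalf]
  have e : θ / R' = (M₂ + R') / R' ^ 2 := by rw [hθ]; field_simp
  rwa [e] at hS

/-- **The annulus bound at a fixed family.**  For an AL1 eigenfamily `f_0,…,f_m`, `0 ≤ E`, `κ` with `E + 96κ² + 3 ≤ physLevel (m+2)`: there are `R' > 0`, `C`, `t₀ > 0` with
`(E − Ct) ∫ g² ≤ kacForm t g` for `0 < t ≤ t₀` and every measurable bounded colour-invariant `g` supported in `{R' ≤ ‖x‖ ≤ κ/√t}`.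
[cite: SimonB1983DiscreteSpectrum, §3] -/
theorem flatKac_annulus_window (hf : IsEigenFamily m f) {E κ : ℝ} (hE : 0 ≤ E)
    (hgap : E + 96 * κ ^ 2 + 3 ≤ physLevel (m + 2)) :
    ∃ R' C t₀ : ℝ, 0 < R' ∧ 0 < t₀ ∧ ∀ t : ℝ, 0 < t → t ≤ t₀ → ∀ g : ZM → ℝ, Measurable g → (∃ M : ℝ, ∀ x, |g x| ≤ M) →
      IsGaugeInv g → (∀ x, g x ≠ 0 → ‖x‖ ≤ κ / Real.sqrt t) → (∀ x, g x ≠ 0 → R' ≤ ‖x‖) →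
        (E - C * t) * ∫ x, g x ^ 2 ≤ kacForm t g := by
  obtain ⟨K, hK0, hK⟩ := kacForm_span_ge hf
  obtain ⟨Cc, hCc0, hCc⟩ := abs_kacBil_span_le hf
  obtain ⟨t₀, D₀, ht₀, hD₀, hR⟩ := kacForm_remainder_ge hf (E := E) (κ := κ) hE hgap
  obtain ⟨M₂, hM₂0, hM₂⟩ := integral_norm_sq_mul_eigSpan_sq_le hf
  refine ⟨E + M₂ + 2, K + Cc ^ 2 + D₀, t₀, by positivity, ht₀, fun t ht htt₀ g hgm hgM hginv hsupp hvan => ?_⟩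
  obtain ⟨M, hgb⟩ := hgM
  have hR'0 : 0 < E + M₂ + 2 := by positivity
  set c : Fin (m + 1) → ℝ := fun j => ∫ x, g x * f j x with hcdef
  have hc : ∀ j, c j = ∫ x, g x * f j x := fun j => rfl
  obtain ⟨hrm, ⟨M', hrb⟩, hri, -, -, hrV, hVFr, horthr, hpyth⟩ := remainder_package hf hgm hgb hsupp hginv c hc
  -- the span `F`
  have hFK : IsKacFn (eigSpan f c) := by rw [eigSpan_eq]; exact isKacFn_span hf c
  obtain ⟨CF, -, hCF⟩ := hFK.exists_bound
  have hFb : ∀ x, |eigSpan f c x| ≤ CF := fun x => (hCF x).1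
  have hFm : Measurable (eigSpan f c) := hFK.continuous.measurable
  -- the decomposition of the Kac form
  have hsplit : kacForm t g = kacForm t (eigSpan f c) + 2 * kacBil t (eigSpan f c) (g - eigSpan f c) +
      kacForm t (g - eigSpan f c) := by
    have e : g = eigSpan f c + (g - eigSpan f c) := (add_sub_cancel (eigSpan f c) g).symm
    conv_lhs => rw [e]
    exact kacForm_add ht hFm hrm hFb hrb hFK.integrable hri hFK.integrable_potential_sq hrV hVFr
  have hS0 : (0 : ℝ) ≤ ∑ j, c j ^ 2 := Finset.sum_nonneg fun j _ => sq_nonneg _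
  have hX0 : 0 ≤ ∫ x, (g - eigSpan f c) x ^ 2 := integral_nonneg fun x => sq_nonneg _
  -- (a) span: `kacForm t F ≥ Σ c_j² E_j − KtΣc² ≥ −KtΣc²` (`E_j ≥ 0`)
  have ha : -(K * t * ∑ j, c j ^ 2) ≤ kacForm t (eigSpan f c) := by
    have h := hK t ht c
    rw [← eigSpan_eq] at h
    have hpos : 0 ≤ ∑ j, c j ^ 2 * physLevel ((j : ℕ) + 1) :=
      Finset.sum_nonneg fun j _ => mul_nonneg (sq_nonneg _) (physLevel_nonneg (by omega))
    linarith
  -- (b) cross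
  have hb : -(Cc ^ 2 * t * (∑ j, c j ^ 2) + ∫ x, (g - eigSpan f c) x ^ 2) ≤
      2 * kacBil t (eigSpan f c) (g - eigSpan f c) := by
    have h := hCc t ht c (g - eigSpan f c) hrm M' hrb hri horthr
    rw [← eigSpan_eq] at h
    have h2 := two_mul_sqrt_bound (C := Cc) ht.le hS0 hX0
    have h3 := neg_abs_le (kacBil t (eigSpan f c) (g - eigSpan f c))
    linarith
  -- (c) remainder
  have hcR := hR t ht htt₀ g M c hgm hgb hginv hsupp hc
  -- (d) tail: `(E+1) Σ c_j² ≤ ∫ g²`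
  have htail := sum_sq_coeff_le_of_vanish hf hM₂0 hM₂ hgm hgb hsupp hR'0 hvan c hc
  have hg2 : ∫ x, g x ^ 2 = (∫ x, (g - eigSpan f c) x ^ 2) + ∑ j, c j ^ 2 := hpyth
  have hG0 : 0 ≤ ∫ x, g x ^ 2 := by rw [hg2]; positivity
  have htail' : (E + 1) * ∑ j, c j ^ 2 ≤ ∫ x, g x ^ 2 := by
    have hfrac : (E + 1) * ((M₂ + (E + M₂ + 2)) / (E + M₂ + 2) ^ 2) ≤ 1 := by
      rw [← mul_div_assoc, div_le_one (by positivity)]; nlinarith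
    calc (E + 1) * ∑ j, c j ^ 2 ≤ (E + 1) * ((M₂ + (E + M₂ + 2)) / (E + M₂ + 2) ^ 2 * ∫ x, g x ^ 2) :=
          mul_le_mul_of_nonneg_left htail (by positivity)
      _ = ((E + 1) * ((M₂ + (E + M₂ + 2)) / (E + M₂ + 2) ^ 2)) * ∫ x, g x ^ 2 := by ring
      _ ≤ 1 * ∫ x, g x ^ 2 := mul_le_mul_of_nonneg_right hfrac hG0
      _ = ∫ x, g x ^ 2 := one_mul _
  -- sum up
  rw [hsplit, hg2]
  rw [hg2] at htail'
  have hKt : 0 ≤ (K + Cc ^ 2 + D₀) * t * ∫ x, (g - eigSpan f c) x ^ 2 := by positivity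
  nlinarith [ha, hb, hcR, hKt, htail']

end Family

/-- ★★ **The flat annulus Kac-form bound** (unconditional; AL1 discharged by `LuscherHamiltonianEigenfunctions_holds`): for every `E ≥ 0` and `κ` there are `R' > 0`, `C`,
`t₀ > 0` such that for `0 < t ≤ t₀` every measurable bounded colour-invariant `g` on `ℝ⁹` supported in the annulus `{R' ≤ ‖x‖ ≤ κ/√t}` satisfies `(E − C t) ∫ g² ≤ kacForm t g` —
the Kac-form shadow of B. Simon's confinement for `𝔥 = −½Δ + ¼Σ|x_i × x_j|²` (states supported far from the origin have energy `≥ E`).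
[cite: SimonB1983DiscreteSpectrum, §3] [cite: Luscher1983, §2] -/
theorem flatKac_annulus {E κ : ℝ} (hE : 0 ≤ E) :
    ∃ R' C t₀ : ℝ, 0 < R' ∧ 0 < t₀ ∧ ∀ t : ℝ, 0 < t → t ≤ t₀ → ∀ g : ZM → ℝ, Measurable g → (∃ M : ℝ, ∀ x, |g x| ≤ M) →
      IsGaugeInv g → (∀ x, g x ≠ 0 → ‖x‖ ≤ κ / Real.sqrt t) → (∀ x, g x ≠ 0 → R' ≤ ‖x‖) →
        (E - C * t) * ∫ x, g x ^ 2 ≤ kacForm t g := by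
  obtain ⟨N, hN⟩ := tendsto_atTop_atTop.1 tendsto_physLevel_atTop (E + 96 * κ ^ 2 + 3)
  obtain ⟨f, hf⟩ := isEigenFamily_of_AL1 N (LuscherHamiltonianEigenfunctions_holds N)
  have hgap : E + 96 * κ ^ 2 + 3 ≤ physLevel (N + 2) := hN _ (Nat.le_add_right _ _)
  exact flatKac_annulus_window hf hE hgap

end Summit.QuantumFields.YangMills.Theorems.FemtoTransferGap.RateTube

end
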